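import Mathlib
import HarnessLib
import Summits.NavierStokesRegularity.NavierStokesRegularity.Theorems.TaylorModelRungThreeCertificateArray

/-!
# Crux K1b-DR (stmt-NavierStokesRegularity-23954), line `taylor-model` — ARRAY ↔ LIST correspondence: the array-coded checker agrees
# with the format-of-record checker on `toLists` (dss_58 (A)(i), equality lemmas)

`CertTablesA.toLists : CertTablesA K → CertTables K` maps the array-coded tables back to the format of record. This file proves that
the array-coded primitives and checkers of `…CertificateArray` compute EXACTLY the list-coded ones on the converted tables:
`vget a.toList = vgetA a`, `mget`, `mulMatN/addVecN/addMatN/smulMatN` vs their `A` twins, `stage/node/step/wgt/coefAt/comp/qTK/qTvec/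
QbVec/basisVec/symQbMat/idMat/rowSumLe/vecEq/matEq`, and finally **`checkNode_toLists : T.toLists.checkNode j s = T.checkNode j s`**
and likewise `checkStep_toLists`, `checkChainStage_toLists`, **`checkChain_toLists : T.toLists.checkChain = T.checkChain`** — so
`chain_of_checks` and the closer apply to `T.toLists` from the ARRAY Booleans (compiled replay), with no change to any landed soundness
theorem. MODEL-lattice rung TL-M3; nothing here is a statement about the Navier–Stokes equations.
-/

-- the sub-problem namespace repeats the summit name by design (D-0017)
set_option linter.dupNamespace false

namespace Summit.NavierStokesRegularity.NavierStokesRegularity.Theorems.TaylorModelCert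

open Literature.Analysis.FluidPDE.TaoCascade

/-! ### Base: `Array.getD` / `toList` / `ofFn` -/

section Base

variable {K : Type} [Field K]

/-- `toList` commutes with `getD`. [folklore] -/
theorem getD_toList' {β : Type} (a : Array β) (c : ℕ) (d : β) : a.toList.getD c d = a.getD c d := by
  simp [Array.getD, List.getD_eq_getElem?_getD]
  split <;> simp_all

/-- `vget ∘ toList = vgetA`. [folklore] -/
theorem vget_toList (a : Array K) (c : ℕ) : vget a.toList c = vgetA a c := by
  unfold vget vgetA; exact getD_toList' a c 0

/-- `getD` through `map`/`toList`. [folklore] -/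
theorem getD_toList_map {β γ : Type} (A : Array β) (f : β → γ) (r : ℕ) (d : β) :
    (A.map f).toList.getD r (f d) = f (A.getD r d) := by
  rw [getD_toList', Array.getD, Array.getD]
  simp only [Array.size_map]
  split <;> simp

/-- List coding of an array matrix. [folklore] -/
def toLL (A : Array (Array K)) : List (List K) := (A.map Array.toList).toList

/-- `mget ∘ toLL = mgetA`. [folklore] -/
theorem mget_toLL (A : Array (Array K)) (r c : ℕ) : mget (toLL A) r c = mgetA A r c := by
  unfold mget mgetA toLL
  rw [show ([] : List K) = (#[] : Array K).toList from rfl, getD_toList_map, getD_toList']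

omit [Field K] in
/-- Rows of `toLL`. [folklore] -/
theorem getD_toLL (A : Array (Array K)) (r : ℕ) : (toLL A).getD r [] = (A.getD r #[]).toList := by
  unfold toLL; rw [show ([] : List K) = (#[] : Array K).toList from rfl, getD_toList_map]

/-- `Array.ofFn` as a `List.range` map. [folklore] -/
theorem ofFn_toList_eq_map {β : Type} {n : ℕ} (f : Fin n → β) (g : ℕ → β) (h : ∀ i : Fin n, f i = g i.val) :
    (Array.ofFn f).toList = (List.range n).map g := by
  apply List.ext_getElem
  · simp
  · intro i h1 h2
    simp [h]

omit [Field K] in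
/-- Nested `Array.ofFn` as a nested `List.range` map. [folklore] -/
theorem ofFn₂_toLL_eq_map {n : ℕ} (f : Fin n → Fin n → K) (g : ℕ → ℕ → K) (h : ∀ i j : Fin n, f i j = g i.val j.val) :
    toLL (Array.ofFn fun r => Array.ofFn fun c => f r c) = (List.range n).map fun r => (List.range n).map fun c => g r c := by
  unfold toLL
  rw [Array.toList_map, Array.toList_ofFn, List.map_ofFn]
  apply List.ext_getElem
  · simp
  · intro i h1 h2
    simp only [List.getElem_ofFn, Function.comp_apply, List.getElem_map, List.getElem_range]
    exact ofFn_toList_eq_map _ _ fun j => h ⟨i, by simpa using h1⟩ j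

omit [Field K] in
/-- Entries of `Array.ofFn` below `n`. [folklore] -/
theorem getD_ofFn_fin {β : Type} {n : ℕ} (f : Fin n → β) (d : β) (i : Fin n) : (Array.ofFn f).getD i.val d = f i := by
  simp [Array.getD]

/-- Entries of `addVecA` below `n`. [folklore] -/
theorem vgetA_addVecA_fin {n : ℕ} (u v : Array K) (r : Fin n) : vgetA (addVecA n u v) r.val = vgetA u r.val + vgetA v r.val := by
  unfold addVecA; unfold vgetA; exact getD_ofFn_fin _ _ r

/-! ### List twins of the array primitives -/

/-- `mulMatA` vs `mulMatN`. [folklore] -/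
theorem toLL_mulMatA (n : ℕ) (A B : Array (Array K)) : toLL (mulMatA n A B) = mulMatN n (toLL A) (toLL B) := by
  unfold mulMatA mulMatN
  refine ofFn₂_toLL_eq_map _ _ fun r c => ?_
  congr 1 <;> funext t <;> simp [mget_toLL]

/-- `addMatA` vs `addMatN`. [folklore] -/
theorem toLL_addMatA (n : ℕ) (A B : Array (Array K)) : toLL (addMatA n A B) = addMatN n (toLL A) (toLL B) := by
  unfold addMatA addMatN
  exact ofFn₂_toLL_eq_map _ _ fun r c => by rw [mget_toLL, mget_toLL]

/-- `smulMatA` vs `smulMatN`. [folklore] -/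
theorem toLL_smulMatA (n : ℕ) (a : K) (A : Array (Array K)) : toLL (smulMatA n a A) = smulMatN n a (toLL A) := by
  unfold smulMatA smulMatN
  exact ofFn₂_toLL_eq_map _ _ fun r c => by rw [mget_toLL]

/-- `zeroMatA` vs the list zero matrix. [folklore] -/
theorem toLL_zeroMatA (n : ℕ) : toLL (zeroMatA (K := K) n) = (List.range n).map fun _ => (List.range n).map fun _ => (0 : K) :=
  ofFn₂_toLL_eq_map _ _ fun _ _ => rfl

/-- `addVecA` vs `addVecN`. [folklore] -/
theorem toList_addVecA (n : ℕ) (u v : Array K) : (addVecA n u v).toList = addVecN n u.toList v.toList := by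
  unfold addVecA addVecN
  exact ofFn_toList_eq_map _ _ fun c => by rw [vget_toList, vget_toList]

/-- `zeroVecA` vs the list zero vector. [folklore] -/
theorem toList_zeroVecA (n : ℕ) : (zeroVecA (K := K) n).toList = (List.range n).map fun _ => (0 : K) :=
  ofFn_toList_eq_map _ _ fun _ => rfl

end Base

/-! ### The tables: `toLists` commutes with the accessors -/

namespace CertTablesA

section Shape

variable {K : Type} (T : CertTablesA K)

/-- `m` is preserved. [folklore] -/
theorem toLists_m : T.toLists.m = T.m := rfl
/-- `n` is preserved. [folklore] -/
theorem toLists_n : T.toLists.n = T.n := rfl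
/-- `idx` is preserved. [folklore] -/
theorem toLists_idx (i : Fin 4) (k : ℤ) : T.toLists.idx i k = T.idx i k := rfl
/-- `pdeg` is preserved. [folklore] -/
theorem toLists_pdeg : T.toLists.pdeg = T.pdeg := rfl

end Shape

section Tables

variable {K : Type} [Field K] (T : CertTablesA K)

/-- Stages commute with `toLists`. [folklore] -/
theorem toLists_stage (j : ℕ) : T.toLists.stage j = (T.stage j).toLists := by
  unfold CertTables.stage stage
  show (T.stages.map StageTablesA.toLists).toList.getD j _ = _
  rw [← getD_toList_map T.stages StageTablesA.toLists j stageDefault]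
  congr 1
  simp [StageTablesA.toLists, stageDefault]

/-- Nodes commute with `toLists`. [folklore] -/
theorem toLists_node (j s : ℕ) : T.toLists.node j s = (T.node j s).toLists := by
  unfold CertTables.node node
  rw [toLists_stage]
  show ((T.stage j).nodes.map NodeTablesA.toLists).toList.getD s _ = _
  rw [← getD_toList_map (T.stage j).nodes NodeTablesA.toLists s nodeDefault]
  congr 1
  simp [NodeTablesA.toLists, nodeDefault]

/-- Sub-steps commute with `toLists`. [folklore] -/
theorem toLists_step (j s : ℕ) : T.toLists.step j s = T.step j s := by
  unfold CertTables.step step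
  rw [toLists_stage]
  show (T.stage j).steps.toList.getD s _ = _
  rw [getD_toList']

/-- Weights commute with `toLists`. [folklore] -/
theorem toLists_wgt (j c : ℕ) : T.toLists.wgt j c = T.wgt j c := by
  unfold CertTables.wgt wgt
  rw [toLists_stage, toLists_m]
  exact vget_toList _ _

/-- Coefficients commute with `toLists`. [folklore] -/
theorem toLists_coefAt (a b i : Fin 4) (μi : ℕ) (k : ℤ) : T.toLists.coefAt a b i μi k = T.coefAt a b i μi k := by
  unfold CertTables.coefAt coefAt
  exact vget_toList _ _

/-- Window components commute with `toLists`. [folklore] -/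
theorem toLists_comp (y : Array K) (i : Fin 4) (k : ℤ) : T.toLists.comp y.toList i k = T.comp y i k := by
  unfold CertTables.comp comp
  simp only [vget_toList]
  rfl

/-- The field commutes with `toLists`. [folklore] -/
theorem toLists_qTK (y : Array K) (i : Fin 4) (k : ℤ) : T.toLists.qTK y.toList i k = T.qTK y i k := by
  unfold CertTables.qTK qTK
  simp only [toLists_coefAt, toLists_comp]

/-- `qTvec` commutes with `toLists`. [folklore] -/
theorem toLists_qTvec (y : Array K) : T.toLists.qTvec y.toList = (T.qTvec y).toList := by
  unfold CertTables.qTvec qTvec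
  rw [toLists_n]
  exact (ofFn_toList_eq_map _ _ fun c => by rw [toLists_qTK]; rfl).symm

/-- `QbVec` commutes with `toLists`. [folklore] -/
theorem toLists_QbVec (u v : Array K) : T.toLists.QbVec u.toList v.toList = (T.QbVec u v).toList := by
  unfold CertTables.QbVec QbVec
  rw [toLists_n, ← toList_addVecA, toLists_qTvec, toLists_qTvec, toLists_qTvec]
  exact (ofFn_toList_eq_map _ _ fun c => by simp only [vget_toList]).symm

/-- `basisVec` commutes with `toLists`. [folklore] -/
theorem toLists_basisVec (c : ℕ) : T.toLists.basisVec c = (T.basisVec c).toList := by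
  unfold CertTables.basisVec basisVec
  rw [toLists_n]
  exact (ofFn_toList_eq_map _ _ fun _ => rfl).symm

/-- `symQbMat` commutes with `toLists`. [folklore] -/
theorem toLists_symQbMat (a : Array K) : T.toLists.symQbMat a.toList = toLL (T.symQbMat a) := by
  unfold CertTables.symQbMat symQbMat
  rw [toLists_n]
  refine (ofFn₂_toLL_eq_map _ _ fun r c => ?_).symm
  rw [toLists_basisVec, toLists_QbVec, toLists_QbVec, vget_toList, vget_toList, getD_ofFn_fin]
  exact vgetA_addVecA_fin _ _ r

/-- `idMat` commutes with `toLists`. [folklore] -/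
theorem toLists_idMat : T.toLists.idMat = toLL T.idMat := by
  unfold CertTables.idMat idMat
  rw [toLists_n]
  exact (ofFn₂_toLL_eq_map _ _ fun _ _ => rfl).symm

/-- `RemK` is preserved. [folklore] -/
theorem toLists_RemK (b mC u : K) : T.toLists.RemK b mC u = T.RemK b mC u := rfl
/-- `RemVK` is preserved. [folklore] -/
theorem toLists_RemVK (b mC u : K) : T.toLists.RemVK b mC u = T.RemVK b mC u := rfl

end Tables

section Checks

variable {K : Type} [Field K] [LinearOrder K] (T : CertTablesA K)

/-- `rowSumLe` agrees. [folklore] -/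
theorem toLists_rowSumLe (A : Array (Array K)) (wIn bound : ℕ → K) :
    T.toLists.rowSumLe (toLL A) wIn bound = T.rowSumLe A wIn bound := by
  unfold CertTables.rowSumLe rowSumLe; simp only [toLists_n, mget_toLL]

/-- `vecEq` agrees. [folklore] -/
theorem toLists_vecEq (u v : Array K) : T.toLists.vecEq u.toList v.toList = T.vecEq u v := by
  unfold CertTables.vecEq vecEq; simp only [toLists_n, vget_toList]

/-- `matEq` agrees. [folklore] -/
theorem toLists_matEq (A B : Array (Array K)) : T.toLists.matEq (toLL A) (toLL B) = T.matEq A B := by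
  unfold CertTables.matEq matEq; simp only [toLists_n, mget_toLL]

end Checks

/-! ### Node records and the node check -/

section NodeEq

variable {K : Type} [Field K] [LinearOrder K] (T : CertTablesA K)

omit [Field K] [LinearOrder K] in
/-- `toLL` of the empty array. [folklore] -/
theorem toLL_empty : toLL (#[] : Array (Array K)) = [] := by simp [toLL]

omit [Field K] [LinearOrder K] in
/-- Rows of a `toLL`-mapped table of matrices. [folklore] -/
theorem getD_map_toLL (W : Array (Array (Array K))) (q : ℕ) : ((W.map toLL).toList).getD q [] = toLL (W.getD q #[]) := by
  have h := getD_toList_map W toLL q #[]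
  rwa [toLL_empty] at h

omit [LinearOrder K] in
/-- `vget ∘ toList = vgetA` as functions. [folklore] -/
theorem vget_toList_fn (a : Array K) : vget a.toList = vgetA a := funext (vget_toList a)

omit [LinearOrder K] in
/-- Weights as functions. [folklore] -/
theorem toLists_wgt_fn (j : ℕ) : T.toLists.wgt j = T.wgt j := funext (T.toLists_wgt j)

omit [LinearOrder K] in
/-- `mulMatN` on converted matrices. [folklore] -/
theorem mulMatN_toLL (n : ℕ) (A B : Array (Array K)) : mulMatN n (toLL A) (toLL B) = toLL (mulMatA n A B) :=
  (toLL_mulMatA n A B).symm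

omit [LinearOrder K] in
/-- `smulMatN` on a converted matrix. [folklore] -/
theorem smulMatN_toLL (n : ℕ) (a : K) (A : Array (Array K)) : smulMatN n a (toLL A) = toLL (smulMatA n a A) :=
  (toLL_smulMatA n a A).symm

omit [LinearOrder K] in
/-- `foldr` of `addVecN` over converted vectors. [folklore] -/
theorem foldr_addVecN_toList (n : ℕ) (l : List ℕ) (g : ℕ → Array K) :
    l.foldr (fun m' acc => addVecN n (g m').toList acc) ((List.range n).map fun _ => (0 : K)) =
      (l.foldr (fun m' acc => addVecA n (g m') acc) (zeroVecA n)).toList := by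
  induction l with
  | nil => simp only [List.foldr_nil]; exact (toList_zeroVecA n).symm
  | cons a l ih => simp only [List.foldr_cons]; rw [ih, ← toList_addVecA]

omit [LinearOrder K] in
/-- `foldr` of `addMatN` over converted matrices. [folklore] -/
theorem foldr_addMatN_toLL (n : ℕ) (l : List ℕ) (g : ℕ → Array (Array K)) :
    l.foldr (fun m' acc => addMatN n (toLL (g m')) acc) ((List.range n).map fun _ => (List.range n).map fun _ => (0 : K)) =
      toLL (l.foldr (fun m' acc => addMatA n (g m') acc) (zeroMatA n)) := by
  induction l with
  | nil => simp only [List.foldr_nil]; exact (toLL_zeroMatA n).symm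
  | cons a l ih => simp only [List.foldr_cons]; rw [ih, ← toLL_addMatA]

omit [LinearOrder K] in
/-- The scaled-jet row of clause a18 as an `Array.ofFn`. [folklore] -/
theorem map_range_jet (n : ℕ) (a : K) (X : Array K) :
    (List.range n).map (fun c => a * vgetA X c) = (Array.ofFn (n := n) fun c => a * vgetA X c.val).toList :=
  (ofFn_toList_eq_map _ _ fun _ => rfl).symm

omit [Field K] [LinearOrder K] in
/-- Field projections of `NodeTablesA.toLists`. [folklore] -/
theorem node_toLists_fields (N : NodeTablesA K) :
    N.toLists.Tn = N.Tn ∧ N.toLists.mC = N.mC ∧ N.toLists.EI = N.EI ∧ N.toLists.E = N.E ∧ N.toLists.EO = N.EO ∧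
      N.toLists.ρ = N.ρ ∧ N.toLists.ρO = N.ρO ∧ N.toLists.NCi = N.NCi ∧ N.toLists.x = N.x.toList ∧ N.toLists.P = toLL N.P ∧
      N.toLists.rP = N.rP.toList ∧ N.toLists.Cm = toLL N.Cm ∧ N.toLists.Ci = toLL N.Ci ∧ N.toLists.W = (N.W.map toLL).toList :=
  ⟨rfl, rfl, rfl, rfl, rfl, rfl, rfl, rfl, rfl, rfl, rfl, rfl, rfl, rfl⟩

/-- **The node check agrees**: `checkNode` of the format of record on `T.toLists` equals the array-coded `checkNode`. [folklore] -/
theorem checkNode_toLists (j s : ℕ) : T.toLists.checkNode j s = T.checkNode j s := by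
  obtain ⟨-, hmC, hEI, hE, hEO, hρ, hρO, hNCi, hx, hP, hrP, hCm, hCi, hW⟩ := node_toLists_fields (T.node j s)
  unfold CertTables.checkNode checkNode
  simp only [toLists_node, toLists_n, toLists_pdeg, toLists_wgt_fn, hmC, hEI, hE, hEO, hρ, hρO, hNCi, hx, hP, hrP, hCm,
    hCi, hW, vget_toList, vget_toList_fn, mulMatN_toLL, toLists_idMat, toLists_matEq, toLists_rowSumLe, getD_toLL,
    toLists_vecEq, getD_map_toLL, smulMatN_toLL, toLists_symQbMat, toLists_QbVec, foldr_addVecN_toList, foldr_addMatN_toLL,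
    map_range_jet]

end NodeEq

/-! ### Sub-steps, stages, the whole chain -/

section StepEq

variable {K : Type} [Field K] [LinearOrder K] (T : CertTablesA K)

omit [Field K] [LinearOrder K] in
/-- Field projections of `StageTablesA.toLists` used by the checkers. [folklore] -/
theorem stage_toLists_fields (G : StageTablesA K) :
    G.toLists.S = G.S ∧ G.toLists.bb = G.bb ∧ G.toLists.κ = G.κ ∧ G.toLists.Λ = G.Λ ∧ G.toLists.δ = G.δ ∧
      G.toLists.ell = toLL G.ell ∧ G.toLists.ctr = G.ctr.toList ∧ G.toLists.rad = G.rad.toList ∧ G.toLists.dm = G.dm :=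
  ⟨rfl, rfl, rfl, rfl, rfl, rfl, rfl, rfl, rfl⟩

omit [Field K] [LinearOrder K] in
/-- Global scalar/list fields of `toLists`. [folklore] -/
theorem toLists_globals : T.toLists.M = T.M.toList ∧ T.toLists.τs = T.τs ∧ T.toLists.mm = T.mm ∧ T.toLists.N₀ = T.N₀ :=
  ⟨rfl, rfl, rfl, rfl⟩

/-- `tpAbs` agrees. [folklore] -/
theorem toLists_tpAbs (N : NodeTablesA K) (h : K) (c : ℕ) : T.toLists.tpAbs N.toLists h c = T.tpAbs N h c := by
  unfold CertTables.tpAbs tpAbs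
  simp only [toLists_pdeg, (node_toLists_fields N).2.2.2.2.2.2.2.2.2.1, getD_toLL, vget_toList]

omit [LinearOrder K] in
/-- `vapMat` agrees. [folklore] -/
theorem toLists_vapMat (N : NodeTablesA K) (h : K) : T.toLists.vapMat N.toLists h = toLL (T.vapMat N h) := by
  unfold CertTables.vapMat vapMat
  simp only [toLists_pdeg, toLists_n, (node_toLists_fields N).2.2.2.2.2.2.2.2.2.2.2.2.2, getD_map_toLL, smulMatN_toLL,
    foldr_addMatN_toLL]

/-- `opNormLe` agrees. [folklore] -/
theorem toLists_opNormLe (j : ℕ) (A : Array (Array K)) (N : K) : T.toLists.opNormLe j (toLL A) N = T.opNormLe j A N := by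
  unfold CertTables.opNormLe opNormLe
  rw [toLists_wgt_fn, toLists_rowSumLe]

/-- **The sub-step check agrees.** [folklore] -/
theorem checkStep_toLists (j s : ℕ) : T.toLists.checkStep j s = T.checkStep j s := by
  obtain ⟨hTn, hmC, hEI, hE, hEO, hρ, hρO, -, -, hP, hrP, hCm, -, hW⟩ := node_toLists_fields (T.node j s)
  obtain ⟨hTn', -, hEI', hE', hEO', -, -, hNCi', hx', -, hrP', -, hCi', -⟩ := node_toLists_fields (T.node j (s + 1))
  obtain ⟨-, hbb, hκ, hΛ, hδ, -, -, -, -⟩ := stage_toLists_fields (T.stage j)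
  obtain ⟨hM, hτ, hmm, -⟩ := T.toLists_globals
  unfold CertTables.checkStep checkStep
  simp only [toLists_node, toLists_stage, toLists_step, toLists_n, toLists_m, toLists_pdeg, toLists_wgt_fn, toLists_RemK,
    toLists_RemVK, hTn, hmC, hEI, hE, hEO, hρ, hρO, hP, hrP, hCm, hW, hTn', hEI', hE', hEO', hNCi', hx', hrP',
    hCi', hbb, hκ, hΛ, hδ, hM, hτ, hmm, vget_toList, vget_toList_fn, getD_toLL, getD_map_toLL, mget_toLL, mulMatN_toLL,
    toLists_rowSumLe, toLists_tpAbs, toLists_vapMat, toLists_opNormLe]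

/-- **The stage check agrees.** [folklore] -/
theorem checkChainStage_toLists (j : ℕ) : T.toLists.checkChainStage j = T.checkChainStage j := by
  obtain ⟨hS, -, -, -, -, hell, hctr, hrad, -⟩ := stage_toLists_fields (T.stage j)
  obtain ⟨hTn0, -, hEI0, -, -, -, -, -, hx0, -⟩ := node_toLists_fields (T.node j 0)
  obtain ⟨-, hτ, -, -⟩ := T.toLists_globals
  unfold CertTables.checkChainStage checkChainStage
  simp only [toLists_stage, toLists_node, toLists_n, hS, hell, hctr, hrad, hTn0, hEI0, hx0, hτ, vget_toList, getD_toLL,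
    checkNode_toLists, checkStep_toLists, (node_toLists_fields (T.node j (T.stage j).S)).1]
  unfold toLL
  rw [Array.length_toList, Array.size_map]

/-- **The chain check agrees**: `checkChain` of the format of record on `T.toLists` IS the array-coded `checkChain`. [folklore] -/
theorem checkChain_toLists : T.toLists.checkChain = T.checkChain := by
  unfold CertTables.checkChain checkChain
  simp only [T.toLists_globals.2.2.2, checkChainStage_toLists]

end StepEq

end CertTablesA

end Summit.NavierStokesRegularity.NavierStokesRegularity.Theorems.TaylorModelCert
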